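import Literature.Analysis.FluidPDE.HydrodynamicImpulseVector
import Literature.Analysis.FluidPDE.VorticityEquation
import Literature.Analysis.FluidPDE.VorticityCalculus
import Literature.Analysis.FluidPDE.LocalBiotSavartCalculus
import HarnessLib

/-!
# Hydrodynamic impulse, III: the IMPULSE BALANCE `d/dt ½∫ x × ω dx = ∫ f dx` of a forced classical
# Navier–Stokes flow on `ℝ³` (Saffman (3.2.9))

Saffman, *Vortex Dynamics* (CUP 1992), §3.2 eq. (9): along an unbounded incompressible flow at rest at infinity
driven by a body force `F`, the hydrodynamic impulse `I = ½ ∫ x × ω dx` ((3.2.8)) obeys `dI/dt = ∫ F dx` — it is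
conserved without force, untouched by viscosity, and changed ONLY by the spatial mean of the force. This file types
the law for the tree's classical solutions `IsClassicalNSSolutionOn S ν f u p` on `ℝ³` (any viscosity `ν`, Euler
included), with the decay hypotheses made explicit:

* `integral_convect_self_eq_zero` — for a `C¹` divergence-free field with `‖u‖² ∈ L¹` and `‖u‖·‖Du‖ ∈ L¹` (e.g.
  `u, Du ∈ L²`), `∫ (u·∇)u dx = 0` (`((u·∇)u)ᵢ = div (uᵢ u)`); `integral_laplacian_eq_zero_of_isDivFree` — for a
  `C³` divergence-free field with `Δu ∈ L¹`, `∫ Δu dx = 0` (`Δu = −curl curl u` is divergence free; zero flux,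
  Saffman (3.2.15) = `integral_eq_zero_of_isDivFree_of_integrable`);
* `IsClassicalNSSolutionOn.timeDerivWithin_vorticity_eq_curl_flux` — the vorticity rate is the curl of the
  PRESSURE-FREE momentum flux, `∂ₜω = curl (νΔu − (u·∇)u + f)` pointwise (momentum equation, `curl ∇p = 0`, and the
  exchange `curl ∂ₜ = ∂ₜ curl` of the tree's `IsSmoothSpaceTimeOn.curl_timeDerivWithin`, on time sets
  `S ⊆ closure (interior S)` of unique differentiability — every interval);
* **`IsClassicalNSSolutionOn.integral_cross_timeDerivWithin_vorticity`** — the INSTANTANEOUS LAW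
  `∫ x × ∂ₜω(t) dx = 2 ∫ f(t) dx` at every `t ∈ S` at which `u(t), Du(t)` are square-integrable-ish
  (`‖u‖², ‖u‖‖Du‖ ∈ L¹`), `Δu(t) ∈ L¹`, `f(t) ∈ L¹` and `x × ∂ₜω(t) ∈ L¹`: Saffman's (3.2.11)
  (`∫ x × curl B = 2∫ B`, tree `integral_cross_curl_eq_two_smul_integral`) applied to the INTEGRABLE field
  `B = νΔu − (u·∇)u + f` — not to `∂ₜu = B − ∇p`, which carries the `O(|x|⁻³)` dipole tail whenever `∫ f ≠ 0` —
  followed by `∫ B = ∫ f`;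
* **`IsClassicalNSSolutionOn.integral_cross_vorticity_sub_eq`** — the INTEGRATED LAW
  `∫ x × ω(t₂) dx − ∫ x × ω(t₁) dx = 2 ∫_{t₁}^{t₂} ∫ f dx dt` on `[t₁, t₂] ⊆ S`, under a uniform integrable
  majorant of `x × ∂ₜω` on the slab (Fubini) and the instantaneous hypotheses at every time;
* `…_apply` / axisymmetric forms: the same for each component, and the axial component `i = 2` in the tree's
  dictionary `(x × ω)₃ = swirl ω = r²·(ω_θ/r)` (`IsAxisymmetric.swirl_curl_eq_cylRadius_sq_mul_angVortQuot`).

Why the hypotheses are what they are: for a smooth flow whose VORTICITY has a first moment (`|x|·|ω|`,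
`|x|·|∇ω|`, `|x|·|∇²ω| ∈ L¹`) and whose velocity is bounded with bounded gradient and finite energy, every
hypothesis holds (`Δu = −curl ω`, `∂ₜω = νΔω − (u·∇)ω + (ω·∇)u + curl f`); the velocity itself need NOT be
integrable (and is not, once `∫∫ f ≠ 0`). The consequence used downstream (cell `ns-blowup`, item 19249's
negative lane): a slice with single-signed `(x × ω)₃` — a vortex ring, Hill's vortex — can only be CREATED BY A
FORCE OF NON-ZERO AXIAL MEAN from data of zero impulse.

References: P. G. Saffman, *Vortex Dynamics*, Cambridge Univ. Press (1992), §3.2 eqs. (3.2.8), (3.2.9), (3.2.11)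
[cite: Saffman1992, §3.2 (3.2.8)–(3.2.11)]; A. J. Majda, A. L. Bertozzi, *Vorticity and Incompressible Flow* (2002),
§1.7 Prop. 1.12 and (1.68) [cite: MajdaBertozziCUP2002, §1.7 Prop. 1.12].
-/

noncomputable section

open MeasureTheory Filter Set Function Topology InnerProductSpace
open scoped RealInnerProductSpace ContDiff Laplacian

namespace Literature.Analysis.FluidPDE


/-! ### §1 Two whole-space integrals that vanish: `∫ (u·∇)u = 0` and `∫ Δu = 0` -/

section Convect

variable {E : Type*} [NormedAddCommGroup E] [InnerProductSpace ℝ E] [FiniteDimensional ℝ E]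
  [MeasurableSpace E] [BorelSpace E]

omit [FiniteDimensional ℝ E] [MeasurableSpace E] [BorelSpace E] in
/-- Pointwise: `div (⟪e, u⟫ u) = ⟪e, u⟫ div u + ⟪e, (u·∇)u⟫` at a point of differentiability
(`div (θ u) = θ div u + ⟪u, ∇θ⟫` with `θ = ⟪e, u⟫`, `⟪u, ∇θ⟫ = Dθ(u) = ⟪e, Du(u)⟫`). [folklore] -/
private theorem divergence_inner_smul_self [FiniteDimensional ℝ E] {u : E → E} {x : E}
    (hu : DifferentiableAt ℝ u x) (e : E) :
    VectorCalculus.divergence (fun y => ⟪e, u y⟫ • u y) x =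
      ⟪e, u x⟫ * VectorCalculus.divergence u x + ⟪e, convect u u x⟫ := by
  have hθ : HasFDerivAt (fun y => ⟪e, u y⟫) ((innerSL ℝ e).comp (fderiv ℝ u x)) x :=
    (innerSL ℝ e).hasFDerivAt.comp x hu.hasFDerivAt
  have hg : ⟪u x, gradient (fun y => ⟪e, u y⟫) x⟫ = ⟪e, convect u u x⟫ := by
    rw [real_inner_comm, gradient, InnerProductSpace.toDual_symm_apply, hθ.fderiv]
    simp [convect]
  rw [divergence_smul_apply hθ.differentiableAt hu, hg]

/-- **`∫ ⟪e, (u·∇)u⟫ dx = 0`** for a `C¹` divergence-free field with `‖u‖² ∈ L¹` and `‖u‖·‖Du‖ ∈ L¹`: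
`⟪e, (u·∇)u⟫ = div (⟪e,u⟫ u)` is the divergence of a field `G` with `‖G‖/(1+|x|) ≤ ‖e‖‖u‖² ∈ L¹` and
`div G ∈ L¹`, so `∫ div G = 0` (tree `PineauVicol2026.integral_divergence_eq_zero_of_integrable_div`). This is
the «momentum flux through large spheres vanishes» step of Saffman's (3.2.9). [cite: Saffman1992, §3.2 eq. (3.2.9)] -/
theorem integral_const_inner_convect_self_eq_zero {u : E → E} (hu : ContDiff ℝ 1 u)
    (hdiv : VectorCalculus.IsDivFree u) (h2 : Integrable fun x => ‖u x‖ ^ 2)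
    (hprod : Integrable fun x => ‖u x‖ * ‖fderiv ℝ u x‖) (e : E) :
    ∫ x, ⟪e, convect u u x⟫ = 0 := by
  have hud : ∀ x, DifferentiableAt ℝ u x := fun x => (hu.differentiable one_ne_zero) x
  set G : E → E := fun y => ⟪e, u y⟫ • u y with hG
  have hG1 : ContDiff ℝ 1 G := (contDiff_const.inner ℝ hu).smul hu
  have hdivG : (fun x => VectorCalculus.divergence G x) = fun x => ⟪e, convect u u x⟫ := by
    funext x
    rw [hG, divergence_inner_smul_self (hud x) e, hdiv x, mul_zero, zero_add]
  have hcont : Continuous fun x => ⟪e, convect u u x⟫ :=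
    continuous_const.inner (((hu.continuous_fderiv one_ne_zero).clm_apply hu.continuous).congr
      fun x => rfl)
  have hdI : Integrable fun x => VectorCalculus.divergence G x := by
    rw [hdivG]
    refine (hprod.const_mul ‖e‖).mono' hcont.aestronglyMeasurable (Eventually.of_forall fun x => ?_)
    rw [Real.norm_eq_abs]
    calc |⟪e, convect u u x⟫| ≤ ‖e‖ * ‖convect u u x‖ := abs_real_inner_le_norm _ _
      _ ≤ ‖e‖ * (‖fderiv ℝ u x‖ * ‖u x‖) := by
          gcongr; exact (fderiv ℝ u x).le_opNorm (u x)
      _ = ‖e‖ * (‖u x‖ * ‖fderiv ℝ u x‖) := by ring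
  have hwI : Integrable fun x => ‖G x‖ / (1 + ‖x‖) := by
    refine (h2.const_mul ‖e‖).mono' ?_ (Eventually.of_forall fun x => ?_)
    · exact ((hG1.continuous.norm).div (continuous_const.add continuous_norm)
        fun x => (by positivity : (1 : ℝ) + ‖x‖ ≠ 0)).aestronglyMeasurable
    · have h1 : (1 : ℝ) ≤ 1 + ‖x‖ := by linarith [norm_nonneg x]
      rw [Real.norm_of_nonneg (by positivity), hG, norm_smul]
      calc ‖⟪e, u x⟫‖ * ‖u x‖ / (1 + ‖x‖) ≤ ‖⟪e, u x⟫‖ * ‖u x‖ := div_le_self (by positivity) h1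
        _ ≤ (‖e‖ * ‖u x‖) * ‖u x‖ := by gcongr; exact norm_inner_le_norm e (u x)
        _ = ‖e‖ * ‖u x‖ ^ 2 := by ring
  have h := PineauVicol2026.integral_divergence_eq_zero_of_integrable_div hG1 hwI hdI
  rwa [hdivG] at h

/-- **`∫ (u·∇)u dx = 0`** (vector form) for a `C¹` divergence-free field on a finite-dimensional inner product
space with `‖u‖² ∈ L¹` and `‖u‖·‖Du‖ ∈ L¹` — in particular for every finite-energy, finite-enstrophy smooth
velocity field. [cite: Saffman1992, §3.2 eq. (3.2.9)] -/
theorem integral_convect_self_eq_zero {u : E → E} (hu : ContDiff ℝ 1 u)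
    (hdiv : VectorCalculus.IsDivFree u) (h2 : Integrable fun x => ‖u x‖ ^ 2)
    (hprod : Integrable fun x => ‖u x‖ * ‖fderiv ℝ u x‖) :
    ∫ x, convect u u x = 0 := by
  by_cases hint : Integrable (fun x => convect u u x)
  · exact integral_eq_zero_of_forall_integral_inner_eq_zero (𝕜 := ℝ) _ hint fun e =>
      integral_const_inner_convect_self_eq_zero hu hdiv h2 hprod e
  · exact integral_undef hint

/-- The convective term is integrable when `‖u‖·‖Du‖` is: `‖(u·∇)u‖ ≤ ‖Du‖ ‖u‖`. [folklore] -/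
private theorem integrable_convect_self_of_norm_mul {u : E → E} (hu : ContDiff ℝ 1 u)
    (hprod : Integrable fun x => ‖u x‖ * ‖fderiv ℝ u x‖) :
    Integrable fun x => convect u u x := by
  refine hprod.mono' (((hu.continuous_fderiv one_ne_zero).clm_apply hu.continuous).congr
      fun x => rfl).aestronglyMeasurable (Eventually.of_forall fun x => ?_)
  calc ‖convect u u x‖ ≤ ‖fderiv ℝ u x‖ * ‖u x‖ := (fderiv ℝ u x).le_opNorm (u x)
    _ = ‖u x‖ * ‖fderiv ℝ u x‖ := mul_comm _ _

end Convect

/-- **`∫ Δu dx = 0`** for a `C³` divergence-free field on `ℝ³` with `Δu ∈ L¹`: `Δu = −curl (curl u)`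
(Majda–Bertozzi Prop. 2.16, tree `laplacian_eq_neg_curl_curl`) is a `C¹` divergence-free (`div curl = 0`)
integrable field, whose total flux vanishes (Saffman (3.2.15), tree `integral_eq_zero_of_isDivFree_of_integrable`).
So viscosity never changes the impulse. [cite: Saffman1992, §3.2 eqs. (3.2.9), (3.2.15)] -/
theorem integral_laplacian_eq_zero_of_isDivFree {u : (EuclideanSpace ℝ (Fin 3)) → (EuclideanSpace ℝ (Fin 3))}
    (hu : ContDiff ℝ 3 u)
    (hdiv : VectorCalculus.IsDivFree u) (hΔ : Integrable fun x => (Δ u) x) :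
    ∫ x, (Δ u) x = 0 := by
  have hu2 : ContDiff ℝ 2 u := hu.of_le (by norm_cast)
  have hω2 : ContDiff ℝ 2 (curl u) := contDiff_curl (n := 2) (by exact_mod_cast hu)
  have hcc1 : ContDiff ℝ 1 (curl (curl u)) := contDiff_curl (n := 1) (by exact_mod_cast hω2)
  have hΔeq : (fun x => (Δ u) x) = fun x => -curl (curl u) x :=
    funext fun x => laplacian_eq_neg_curl_curl hu2 hdiv x
  have hccI : Integrable (curl (curl u)) := by
    have h := hΔ.neg
    rw [hΔeq] at h
    simpa using h
  have hccdiv : VectorCalculus.IsDivFree (curl (curl u)) := fun x =>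
    divergence_curl_eq_zero_holds (curl u) hω2 x
  have h0 := integral_eq_zero_of_isDivFree_of_integrable hcc1 hccdiv hccI
  rw [hΔeq, integral_neg]
  simpa using h0

/-- A component of the Bochner integral of an `ℝ³`-valued field is the integral of the component (any measure).
[folklore] -/
private theorem integral_apply_coord {α : Type*} [MeasurableSpace α] {μ : Measure α}
    {F : α → (EuclideanSpace ℝ (Fin 3))}
    (hF : Integrable F μ) (i : Fin 3) : (∫ a, F a ∂μ) i = ∫ a, F a i ∂μ :=
  ((EuclideanSpace.proj i : (EuclideanSpace ℝ (Fin 3)) →L[ℝ] ℝ).integral_comp_comm hF).symm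

/-! ### §2 The vorticity rate is the curl of the pressure-free momentum flux -/

section Dynamics

variable {S : Set ℝ} {ν : ℝ} {f u : ℝ → (EuclideanSpace ℝ (Fin 3)) → (EuclideanSpace ℝ (Fin 3))}
  {p : ℝ → (EuclideanSpace ℝ (Fin 3)) → ℝ}

/-- The momentum equation solved for the acceleration: `∂ₜu = (νΔu − (u·∇)u + f) − ∇p` on `S × ℝ³`
(Fefferman (1)). [folklore] -/
private theorem IsClassicalNSSolutionOn.timeDerivWithin_eq_flux_sub_gradient
    (h : IsClassicalNSSolutionOn S ν f u p) {t : ℝ} (ht : t ∈ S) (x : (EuclideanSpace ℝ (Fin 3))) :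
    timeDerivWithin S u t x =
      (ν • (Δ (u t)) x - convect (u t) (u t) x + f t x) - gradient (p t) x := by
  have e := h.momentum t ht x
  have e' : timeDerivWithin S u t x =
      ν • (Δ (u t)) x - gradient (p t) x + f t x - convect (u t) (u t) x := by
    rw [← e]; abel
  rw [e']; abel

/-- The pressure-free momentum flux `B = νΔu − (u·∇)u + f` of a classical solution is a smooth slice field
(on a time set of unique differentiability; the force is smooth by `isSmoothSpaceTimeOn_force`). [folklore] -/
private theorem IsClassicalNSSolutionOn.contDiff_flux (h : IsClassicalNSSolutionOn S ν f u p)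
    (hS : UniqueDiffOn ℝ S) {t : ℝ} (ht : t ∈ S) :
    ContDiff ℝ ∞ fun y => ν • (Δ (u t)) y - convect (u t) (u t) y + f t y := by
  have hΔ : ContDiff ℝ ∞ fun y => (Δ (u t)) y := (h.smooth_velocity.laplacian hS).contDiff_slice ht
  have hG : ContDiff ℝ ∞ fun y => convect (u t) (u t) y :=
    (h.smooth_velocity.convect h.smooth_velocity hS).contDiff_slice ht
  have hf : ContDiff ℝ ∞ (f t) := (h.isSmoothSpaceTimeOn_force hS).contDiff_slice ht
  exact ((hΔ.const_smul ν).sub hG).add hf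

/-- **`∂ₜω = curl (νΔu − (u·∇)u + f)`**: for a classical Navier–Stokes solution on a time set `S` of unique
differentiability with `S ⊆ closure (interior S)` (every interval), the within-`S` time derivative of the
vorticity `ω = curl u` is, pointwise, the curl of the pressure-free momentum flux — `curl ∂ₜu = ∂ₜ curl u`
(tree `IsSmoothSpaceTimeOn.curl_timeDerivWithin`) and `curl ∇p = 0` (tree `curl_gradient_eq_zero_holds`).
[cite: MajdaBertozziCUP2002, §2.1 eq. (2.5) (curl of the Navier–Stokes equations)] -/
theorem IsClassicalNSSolutionOn.timeDerivWithin_vorticity_eq_curl_flux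
    (h : IsClassicalNSSolutionOn S ν f u p) (hS : UniqueDiffOn ℝ S) (hcl : S ⊆ closure (interior S))
    {t : ℝ} (ht : t ∈ S) (x : (EuclideanSpace ℝ (Fin 3))) :
    timeDerivWithin S (vorticity u) t x =
      curl (fun y => ν • (Δ (u t)) y - convect (u t) (u t) y + f t y) x := by
  have hp2 : ContDiff ℝ 2 (p t) := (h.contDiff_pressure ht).of_le (by norm_cast)
  have hgrad : ContDiff ℝ ∞ fun y => gradient (p t) y := (h.smooth_pressure.gradient hS).contDiff_slice ht
  have dB : DifferentiableAt ℝ (fun y => ν • (Δ (u t)) y - convect (u t) (u t) y + f t y) x :=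
    ((h.contDiff_flux hS ht).differentiable (by simp)) x
  have dgrad : DifferentiableAt ℝ (fun y => gradient (p t) y) x := (hgrad.differentiable (by simp)) x
  have hEq : timeDerivWithin S u t = fun y =>
      (ν • (Δ (u t)) y - convect (u t) (u t) y + f t y) - gradient (p t) y :=
    funext fun y => h.timeDerivWithin_eq_flux_sub_gradient ht y
  rw [← h.smooth_velocity.curl_timeDerivWithin hS hcl ht x, hEq, curl_sub dB dgrad,
    curl_gradient_eq_zero_holds _ hp2 x, sub_zero]

/-! ### §3 The instantaneous impulse law `∫ x × ∂ₜω dx = 2 ∫ f dx` (Saffman (3.2.9)) -/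

/-- **SAFFMAN'S IMPULSE LAW, INSTANTANEOUS FORM** (Saffman 1992, §3.2 (9): `dI/dt = ∫ F dV`, `I = ½∫ x × ω`).
Let `(u, p)` be a classical solution of the Navier–Stokes system with viscosity `ν` and force `f` on `S × ℝ³`,
`S` of unique differentiability with `S ⊆ closure (interior S)`, and let `t ∈ S` be a time at which
`‖u(t)‖² ∈ L¹` and `‖u(t)‖·‖Du(t)‖ ∈ L¹` (finite energy and enstrophy suffice), `Δu(t) ∈ L¹`, `f(t) ∈ L¹`, and
the impulse-rate density `x × ∂ₜω(t, x)` is integrable. Then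
`∫ x × ∂ₜω(t, x) dx = 2 ∫ f(t, x) dx`.
Proof: `∂ₜω = curl B` with `B = νΔu − (u·∇)u + f ∈ C¹ ∩ L¹` (`timeDerivWithin_vorticity_eq_curl_flux`); Saffman's
(3.2.11) for integrable fields (`integral_cross_curl_eq_two_smul_integral`) gives `∫ x × curl B = 2∫ B`; and
`∫ B = ν∫Δu − ∫(u·∇)u + ∫f = ∫ f` (`integral_laplacian_eq_zero_of_isDivFree`, `integral_convect_self_eq_zero`).
The velocity `u(t)` itself is NOT assumed integrable (it is `O(|x|⁻³)` once the impulse is non-zero).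
[cite: Saffman1992, §3.2 eqs. (3.2.9), (3.2.11)] -/
theorem IsClassicalNSSolutionOn.integral_cross_timeDerivWithin_vorticity
    (h : IsClassicalNSSolutionOn S ν f u p) (hS : UniqueDiffOn ℝ S) (hcl : S ⊆ closure (interior S))
    {t : ℝ} (ht : t ∈ S)
    (h2 : Integrable fun x => ‖u t x‖ ^ 2)
    (hprod : Integrable fun x => ‖u t x‖ * ‖fderiv ℝ (u t) x‖)
    (hΔ : Integrable fun x => (Δ (u t)) x) (hf : Integrable (f t))
    (hI : Integrable fun x => cross x (timeDerivWithin S (vorticity u) t x)) :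
    ∫ x, cross x (timeDerivWithin S (vorticity u) t x) = (2 : ℝ) • ∫ x, f t x := by
  set B : (EuclideanSpace ℝ (Fin 3)) → (EuclideanSpace ℝ (Fin 3)) :=
    fun y => ν • (Δ (u t)) y - convect (u t) (u t) y + f t y with hB
  have hu1 : ContDiff ℝ 1 (u t) := (h.contDiff_velocity ht).of_le (by norm_cast)
  have hu3 : ContDiff ℝ 3 (u t) := (h.contDiff_velocity ht).of_le (by norm_cast)
  have hdiv : VectorCalculus.IsDivFree (u t) := h.divFree t ht
  have hrate : (fun x => cross x (timeDerivWithin S (vorticity u) t x)) = fun x => cross x (curl B x) :=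
    funext fun x => by rw [h.timeDerivWithin_vorticity_eq_curl_flux hS hcl ht x]
  have hB1 : ContDiff ℝ 1 B := (h.contDiff_flux hS ht).of_le (by norm_cast)
  have hconv : Integrable fun x => convect (u t) (u t) x := integrable_convect_self_of_norm_mul hu1 hprod
  have hνΔ : Integrable fun x => ν • (Δ (u t)) x := hΔ.smul ν
  have hBint : Integrable B := (hνΔ.sub hconv).add hf
  have hIB : Integrable fun x => cross x (curl B x) := by rw [← hrate]; exact hI
  have h1 := integral_cross_curl_eq_two_smul_integral hB1 hBint hIB
  have h3 : ∫ x, B x = ∫ x, f t x := by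
    have e1 : ∫ x, B x = (∫ x, (ν • (Δ (u t)) x - convect (u t) (u t) x)) + ∫ x, f t x :=
      integral_add (hνΔ.sub hconv) hf
    have e2 : ∫ x, (ν • (Δ (u t)) x - convect (u t) (u t) x) =
        (∫ x, ν • (Δ (u t)) x) - ∫ x, convect (u t) (u t) x := integral_sub hνΔ hconv
    rw [e1, e2, integral_smul, integral_laplacian_eq_zero_of_isDivFree hu3 hdiv hΔ,
      integral_convect_self_eq_zero hu1 hdiv h2 hprod, smul_zero, sub_zero, zero_add]
  rw [hrate, h1, h3]

/-- Componentwise form of the instantaneous law: `∫ (x × ∂ₜω)ᵢ dx = 2 ∫ fᵢ dx`, `i ∈ {0,1,2}`; the axial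
component `i = 2` reads `∫ swirl (∂ₜω) = 2 ∫ f₃` in the tree's `swirl` notation. [cite: Saffman1992, §3.2 eq. (3.2.9)] -/
theorem IsClassicalNSSolutionOn.integral_cross_timeDerivWithin_vorticity_apply
    (h : IsClassicalNSSolutionOn S ν f u p) (hS : UniqueDiffOn ℝ S) (hcl : S ⊆ closure (interior S))
    {t : ℝ} (ht : t ∈ S)
    (h2 : Integrable fun x => ‖u t x‖ ^ 2)
    (hprod : Integrable fun x => ‖u t x‖ * ‖fderiv ℝ (u t) x‖)
    (hΔ : Integrable fun x => (Δ (u t)) x) (hf : Integrable (f t))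
    (hI : Integrable fun x => cross x (timeDerivWithin S (vorticity u) t x)) (i : Fin 3) :
    ∫ x, cross x (timeDerivWithin S (vorticity u) t x) i = 2 * ∫ x, f t x i := by
  have e := congrArg (fun v : (EuclideanSpace ℝ (Fin 3)) => v i)
    (h.integral_cross_timeDerivWithin_vorticity hS hcl ht h2 hprod hΔ hf hI)
  simp only [PiLp.smul_apply, smul_eq_mul] at e
  rw [integral_apply_coord hI, integral_apply_coord hf] at e
  exact e

/-! ### §4 The integrated impulse law `∫ x × ω(t₂) − ∫ x × ω(t₁) = 2 ∫_{t₁}^{t₂} ∫ f` -/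

/-- A slice of a field continuous on `T × ℝ³` and dominated there by an integrable function of `x` is
integrable. [folklore] -/
private theorem integrable_slice_of_dominated {w : ℝ → (EuclideanSpace ℝ (Fin 3)) → (EuclideanSpace ℝ (Fin 3))}
    {T : Set ℝ}
    (hw : ContinuousOn (uncurry w) (T ×ˢ univ)) {G : (EuclideanSpace ℝ (Fin 3)) → ℝ} (hG : Integrable G)
    (hwG : ∀ s ∈ T, ∀ x, ‖w s x‖ ≤ G x) {s : ℝ} (hs : s ∈ T) : Integrable (w s) := by
  have hc : Continuous (w s) := by
    have h1 : ContinuousOn (fun x : (EuclideanSpace ℝ (Fin 3)) => uncurry w (s, x)) univ :=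
      hw.comp (continuous_const.prodMk continuous_id).continuousOn
        fun x _ => mk_mem_prod hs (mem_univ x)
    exact continuousOn_univ.1 h1
  exact hG.mono' hc.aestronglyMeasurable (Eventually.of_forall (hwG s hs))

/-- A field continuous on `[a, b] × ℝ³` and dominated there by an integrable function of `x` is integrable for
`dt|_(a,b) ⊗ dx`. [folklore] -/
private theorem integrable_prod_of_dominated {D : ℝ × (EuclideanSpace ℝ (Fin 3)) → (EuclideanSpace ℝ (Fin 3))}
    {a b : ℝ}
    (hD : ContinuousOn D (Icc a b ×ˢ univ)) {G : (EuclideanSpace ℝ (Fin 3)) → ℝ} (hG : Integrable G)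
    (hDG : ∀ s ∈ Icc a b, ∀ x, ‖D (s, x)‖ ≤ G x) :
    Integrable D (((volume : Measure ℝ).restrict (Ioo a b)).prod
      (volume : Measure (EuclideanSpace ℝ (Fin 3)))) := by
  have h1 : Integrable (fun z : ℝ × (EuclideanSpace ℝ (Fin 3)) => (1 : ℝ) * G z.2)
      (((volume : Measure ℝ).restrict (Ioo a b)).prod (volume : Measure (EuclideanSpace ℝ (Fin 3)))) :=
    (integrable_const (1 : ℝ)).mul_prod hG
  refine Integrable.mono' (g := fun z => G z.2) (by simpa only [one_mul] using h1)
    (aestronglyMeasurable_prod_of_continuousOn hD) ?_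
  · rw [Measure.restrict_prod_eq_prod_univ]
    filter_upwards [ae_restrict_mem (measurableSet_Ioo.prod MeasurableSet.univ)] with z hz
    exact hDG z.1 (Ioo_subset_Icc_self hz.1) z.2

/-- The vorticity of a jointly smooth velocity is jointly smooth (the tree's
`IsSmoothSpaceTimeOn.isSmoothSpaceTimeOn_vorticity`, re-derived in two lines to keep the imports short). [folklore] -/
private theorem isSmoothSpaceTimeOn_vorticity_aux {u : ℝ → (EuclideanSpace ℝ (Fin 3)) → (EuclideanSpace ℝ (Fin 3))}
    (h : IsSmoothSpaceTimeOn S u)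
    (hS : UniqueDiffOn ℝ S) : IsSmoothSpaceTimeOn S (vorticity u) := by
  have e : vorticity u = fun t x => curlCLM (fderiv ℝ (u t) x) := by funext t x; rfl
  rw [e]
  exact (h.fderiv_slice hS).clm_comp curlCLM
set_option maxHeartbeats 400000 in -- buildfix (bf3-g31): 160k/180k FAIL, 200k PASS at accept time; line-neutral budget line
/-- **SAFFMAN'S IMPULSE LAW, INTEGRATED FORM** (Saffman 1992, §3.2 (9): `I(t₂) − I(t₁) = ∫_{t₁}^{t₂} ∫ F dV dt`,
`I = ½ ∫ x × ω`). Let `(u, p)` be a classical solution of the Navier–Stokes system with viscosity `ν` and force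
`f` on `S × ℝ³` (`S` of unique differentiability, `S ⊆ closure (interior S)`) and `[t₁, t₂] ⊆ S`. Assume, at
every time `s ∈ [t₁, t₂]`: `‖u(s)‖², ‖u(s)‖·‖Du(s)‖ ∈ L¹` (finite energy and enstrophy), `Δu(s) ∈ L¹`; a common
integrable majorant `F` of the force slices `f(s, ·)` and a common integrable majorant `g` of the impulse-rate
densities `x × ∂ₜω(s, ·)` on the slab; and integrable impulse densities `x × ω` at the two ends. Then
`∫ x × ω(t₂, x) dx − ∫ x × ω(t₁, x) dx = 2 ∫_{t₁}^{t₂} ∫ f(s, x) dx ds`.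
Proof: per `x`, `x × ω(t₂,x) − x × ω(t₁,x) = ∫_{t₁}^{t₂} x × ∂ₜω(s,x) ds` (FTC along the smooth time line);
Fubini on `(t₁,t₂) × ℝ³` under the majorant `g`; the instantaneous law at every `s`.
[cite: Saffman1992, §3.2 eqs. (3.2.8), (3.2.9)] -/
theorem IsClassicalNSSolutionOn.integral_cross_vorticity_sub_eq
    (h : IsClassicalNSSolutionOn S ν f u p) (hS : UniqueDiffOn ℝ S) (hcl : S ⊆ closure (interior S))
    {t₁ t₂ : ℝ} (h12 : t₁ ≤ t₂) (hsub : Icc t₁ t₂ ⊆ S)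
    (h2 : ∀ s ∈ Icc t₁ t₂, Integrable fun x => ‖u s x‖ ^ 2)
    (hprod : ∀ s ∈ Icc t₁ t₂, Integrable fun x => ‖u s x‖ * ‖fderiv ℝ (u s) x‖)
    (hΔ : ∀ s ∈ Icc t₁ t₂, Integrable fun x => (Δ (u s)) x)
    {F : (EuclideanSpace ℝ (Fin 3)) → ℝ} (hF : Integrable F)
    (hfF : ∀ s ∈ Icc t₁ t₂, ∀ x, ‖f s x‖ ≤ F x)
    {g : (EuclideanSpace ℝ (Fin 3)) → ℝ} (hg : Integrable g)
    (hIg : ∀ s ∈ Icc t₁ t₂, ∀ x, ‖cross x (timeDerivWithin S (vorticity u) s x)‖ ≤ g x)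
    (hω₁ : Integrable fun x => cross x (curl (u t₁) x))
    (hω₂ : Integrable fun x => cross x (curl (u t₂) x)) :
    (∫ x, cross x (curl (u t₂) x)) - ∫ x, cross x (curl (u t₁) x) =
      (2 : ℝ) • ∫ s in t₁..t₂, ∫ x, f s x := by
  rcases eq_or_lt_of_le h12 with rfl | h12'
  · simp
  have hω : IsSmoothSpaceTimeOn S (vorticity u) := isSmoothSpaceTimeOn_vorticity_aux h.smooth_velocity hS
  have hωt : IsSmoothSpaceTimeOn S (timeDerivWithin S (vorticity u)) := hω.timeDerivWithin hS
  have hft : ContinuousOn (uncurry f) (Icc t₁ t₂ ×ˢ univ) :=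
    (h.isSmoothSpaceTimeOn_force hS).continuousOn.mono (prod_mono hsub Subset.rfl)
  have hωtc : ContinuousOn (uncurry (timeDerivWithin S (vorticity u))) (Icc t₁ t₂ ×ˢ univ) :=
    hωt.continuousOn.mono (prod_mono hsub Subset.rfl)
  -- the impulse-rate density on the slab
  set D : ℝ × (EuclideanSpace ℝ (Fin 3)) → (EuclideanSpace ℝ (Fin 3)) :=
    fun z => cross z.2 (timeDerivWithin S (vorticity u) z.1 z.2) with hD
  have hDcont : ContinuousOn D (Icc t₁ t₂ ×ˢ univ) :=
    crossCLM.continuous₂.comp_continuousOn (continuous_snd.continuousOn.prodMk hωtc)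
  have hDc' : ContinuousOn (uncurry fun s x => cross x (timeDerivWithin S (vorticity u) s x))
      (Icc t₁ t₂ ×ˢ univ) := hDcont
  -- slices are integrable
  have hfint : ∀ s ∈ Icc t₁ t₂, Integrable (f s) := fun s hs =>
    integrable_slice_of_dominated hft hF hfF hs
  have hIint : ∀ s ∈ Icc t₁ t₂, Integrable fun x => cross x (timeDerivWithin S (vorticity u) s x) :=
    fun s hs => integrable_slice_of_dominated hDc' hg hIg hs
  -- Fubini
  have hDint :
      Integrable D (((volume : Measure ℝ).restrict (Ioo t₁ t₂)).prod
        (volume : Measure (EuclideanSpace ℝ (Fin 3)))) :=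
    integrable_prod_of_dominated hDcont hg hIg
  have hswap := integral_integral_swap (f := fun s x => D (s, x)) hDint
  -- the fundamental theorem of calculus along each time line
  have hline : ∀ x, ∫ s in Ioo t₁ t₂, D (s, x) = cross x (curl (u t₂) x) - cross x (curl (u t₁) x) := by
    intro x
    have hcont : ContinuousOn (fun s => cross x (vorticity u s x)) (Icc t₁ t₂) :=
      (crossCLM x).continuous.comp_continuousOn (hω.continuousOn.comp
        (Continuous.prodMk_left x).continuousOn fun s hs => mk_mem_prod (hsub hs) (mem_univ x))
    have hderiv : ∀ s ∈ Ioo t₁ t₂,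
        HasDerivWithinAt (fun s => cross x (vorticity u s x)) (D (s, x)) (Ioi s) s := by
      intro s hs
      have hsS : S ∈ 𝓝 s := mem_of_superset (Icc_mem_nhds hs.1 hs.2) hsub
      have h1 : HasDerivAt (fun σ => vorticity u σ x) (timeDerivWithin S (vorticity u) s x) s :=
        (hω.hasDerivWithinAt_timeDerivWithin hS (hsub (Ioo_subset_Icc_self hs)) x).hasDerivAt hsS
      exact ((crossCLM x).hasFDerivAt.comp_hasDerivAt s h1).hasDerivWithinAt
    have hint : IntervalIntegrable (fun s => D (s, x)) volume t₁ t₂ := by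
      refine ContinuousOn.intervalIntegrable ?_
      rw [uIcc_of_le h12]
      exact hDcont.comp (Continuous.prodMk_left x).continuousOn fun s hs => mk_mem_prod hs (mem_univ x)
    have e := intervalIntegral.integral_eq_sub_of_hasDeriv_right_of_le h12 hcont hderiv hint
    rw [intervalIntegral.integral_of_le h12, integral_Ioc_eq_integral_Ioo] at e
    rw [e]
    rfl
  have hlhs : ∫ x, ∫ s in Ioo t₁ t₂, D (s, x) =
      (∫ x, cross x (curl (u t₂) x)) - ∫ x, cross x (curl (u t₁) x) := by
    rw [integral_congr_ae (Eventually.of_forall hline)]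
    exact integral_sub hω₂ hω₁
  -- the instantaneous law at every interior time
  have hrhs : ∫ s in Ioo t₁ t₂, ∫ x, D (s, x) = ∫ s in Ioo t₁ t₂, (2 : ℝ) • ∫ x, f s x := by
    refine setIntegral_congr_fun measurableSet_Ioo fun s hs => ?_
    have hsI := Ioo_subset_Icc_self hs
    exact h.integral_cross_timeDerivWithin_vorticity hS hcl (hsub hsI) (h2 s hsI) (hprod s hsI)
      (hΔ s hsI) (hfint s hsI) (hIint s hsI)
  rw [← hlhs, ← hswap, hrhs, integral_smul, intervalIntegral.integral_of_le h12,
    integral_Ioc_eq_integral_Ioo]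

/-- The time integral of the force's spatial mean, componentwise: under a common integrable majorant on the slab,
`s ↦ ∫ f(s, x) dx` is integrable on `(t₁, t₂)` and `(∫_{t₁}^{t₂} ∫ f)ᵢ = ∫_{t₁}^{t₂} ∫ fᵢ`. [folklore] -/
private theorem IsClassicalNSSolutionOn.intervalIntegral_integral_force_apply
    (h : IsClassicalNSSolutionOn S ν f u p) (hS : UniqueDiffOn ℝ S)
    {t₁ t₂ : ℝ} (h12 : t₁ ≤ t₂) (hsub : Icc t₁ t₂ ⊆ S)
    {F : (EuclideanSpace ℝ (Fin 3)) → ℝ} (hF : Integrable F)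
    (hfF : ∀ s ∈ Icc t₁ t₂, ∀ x, ‖f s x‖ ≤ F x) (i : Fin 3) :
    (∫ s in t₁..t₂, ∫ x, f s x) i = ∫ s in t₁..t₂, ∫ x, f s x i := by
  have hft : ContinuousOn (uncurry f) (Icc t₁ t₂ ×ˢ univ) :=
    (h.isSmoothSpaceTimeOn_force hS).continuousOn.mono (prod_mono hsub Subset.rfl)
  have hfint : ∀ s ∈ Icc t₁ t₂, Integrable (f s) := fun s hs =>
    integrable_slice_of_dominated hft hF hfF hs
  have hfprod : Integrable (uncurry f)
      (((volume : Measure ℝ).restrict (Ioo t₁ t₂)).prod (volume : Measure (EuclideanSpace ℝ (Fin 3)))) :=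
    integrable_prod_of_dominated hft hF hfF
  have hmean : Integrable (fun s => ∫ x, f s x) ((volume : Measure ℝ).restrict (Ioo t₁ t₂)) :=
    hfprod.integral_prod_left
  rw [intervalIntegral.integral_of_le h12, intervalIntegral.integral_of_le h12,
    integral_Ioc_eq_integral_Ioo, integral_Ioc_eq_integral_Ioo, integral_apply_coord hmean i]
  refine setIntegral_congr_fun measurableSet_Ioo fun s hs => ?_
  exact integral_apply_coord (hfint s (Ioo_subset_Icc_self hs)) i

/-- **Componentwise form of the integrated law**: for `i ∈ {0,1,2}`,
`∫ (x × ω)ᵢ(t₂) dx − ∫ (x × ω)ᵢ(t₁) dx = 2 ∫_{t₁}^{t₂} ∫ fᵢ dx ds`; for `i = 2` the densities are the tree's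
`swirl ω = (x × ω)₃`, and for an axisymmetric slice `swirl ω = r²·(ω_θ/r)`
(`IsAxisymmetric.swirl_curl_eq_cylRadius_sq_mul_angVortQuot`): twice Saffman's axial impulse `I₃`.
[cite: Saffman1992, §3.2 eqs. (3.2.8), (3.2.9)] -/
theorem IsClassicalNSSolutionOn.integral_cross_vorticity_sub_eq_apply
    (h : IsClassicalNSSolutionOn S ν f u p) (hS : UniqueDiffOn ℝ S) (hcl : S ⊆ closure (interior S))
    {t₁ t₂ : ℝ} (h12 : t₁ ≤ t₂) (hsub : Icc t₁ t₂ ⊆ S)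
    (h2 : ∀ s ∈ Icc t₁ t₂, Integrable fun x => ‖u s x‖ ^ 2)
    (hprod : ∀ s ∈ Icc t₁ t₂, Integrable fun x => ‖u s x‖ * ‖fderiv ℝ (u s) x‖)
    (hΔ : ∀ s ∈ Icc t₁ t₂, Integrable fun x => (Δ (u s)) x)
    {F : (EuclideanSpace ℝ (Fin 3)) → ℝ} (hF : Integrable F)
    (hfF : ∀ s ∈ Icc t₁ t₂, ∀ x, ‖f s x‖ ≤ F x)
    {g : (EuclideanSpace ℝ (Fin 3)) → ℝ} (hg : Integrable g)
    (hIg : ∀ s ∈ Icc t₁ t₂, ∀ x, ‖cross x (timeDerivWithin S (vorticity u) s x)‖ ≤ g x)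
    (hω₁ : Integrable fun x => cross x (curl (u t₁) x))
    (hω₂ : Integrable fun x => cross x (curl (u t₂) x)) (i : Fin 3) :
    (∫ x, cross x (curl (u t₂) x) i) - ∫ x, cross x (curl (u t₁) x) i =
      2 * ∫ s in t₁..t₂, ∫ x, f s x i := by
  have e := congrArg (fun v : (EuclideanSpace ℝ (Fin 3)) => v i)
    (h.integral_cross_vorticity_sub_eq hS hcl h12 hsub h2 hprod hΔ hF hfF hg hIg hω₁ hω₂)
  simp only [PiLp.sub_apply, PiLp.smul_apply, smul_eq_mul] at e
  rw [integral_apply_coord hω₂, integral_apply_coord hω₁,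
    h.intervalIntegral_integral_force_apply hS h12 hsub hF hfF i] at e
  exact e

/-- **THE AXIAL IMPULSE LAW** in the tree's `swirl` notation (`swirl ω x = x₀ω₁ − x₁ω₀ = (x × ω)₃`):
`∫ swirl(ω(t₂)) dx − ∫ swirl(ω(t₁)) dx = 2 ∫_{t₁}^{t₂} ∫ f₃ dx ds`. For axisymmetric slices
`∫ swirl ω = ∫ r²(ω_θ/r) = 2 I₃` (Saffman (3.2.8)). [cite: Saffman1992, §3.2 eqs. (3.2.8), (3.2.9)] -/
theorem IsClassicalNSSolutionOn.integral_swirl_vorticity_sub_eq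
    (h : IsClassicalNSSolutionOn S ν f u p) (hS : UniqueDiffOn ℝ S) (hcl : S ⊆ closure (interior S))
    {t₁ t₂ : ℝ} (h12 : t₁ ≤ t₂) (hsub : Icc t₁ t₂ ⊆ S)
    (h2 : ∀ s ∈ Icc t₁ t₂, Integrable fun x => ‖u s x‖ ^ 2)
    (hprod : ∀ s ∈ Icc t₁ t₂, Integrable fun x => ‖u s x‖ * ‖fderiv ℝ (u s) x‖)
    (hΔ : ∀ s ∈ Icc t₁ t₂, Integrable fun x => (Δ (u s)) x)
    {F : (EuclideanSpace ℝ (Fin 3)) → ℝ} (hF : Integrable F)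
    (hfF : ∀ s ∈ Icc t₁ t₂, ∀ x, ‖f s x‖ ≤ F x)
    {g : (EuclideanSpace ℝ (Fin 3)) → ℝ} (hg : Integrable g)
    (hIg : ∀ s ∈ Icc t₁ t₂, ∀ x, ‖cross x (timeDerivWithin S (vorticity u) s x)‖ ≤ g x)
    (hω₁ : Integrable fun x => cross x (curl (u t₁) x))
    (hω₂ : Integrable fun x => cross x (curl (u t₂) x)) :
    (∫ x, swirl (curl (u t₂)) x) - ∫ x, swirl (curl (u t₁)) x =
      2 * ∫ s in t₁..t₂, ∫ x, f s x 2 := by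
  have e := h.integral_cross_vorticity_sub_eq_apply hS hcl h12 hsub h2 hprod hΔ hF hfF hg hIg hω₁ hω₂ 2
  have hc : ∀ (v : (EuclideanSpace ℝ (Fin 3)) → (EuclideanSpace ℝ (Fin 3))) (x : (EuclideanSpace ℝ (Fin 3))),
      cross x (curl v x) 2 = swirl (curl v) x := fun v x => by
    simp [cross, cross_apply, swirl]
  simp only [hc] at e
  exact e

end Dynamics

end Literature.Analysis.FluidPDE

end
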